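/-
Copyright (c) 2026 the pub-hodgecm-mathlib formalisation cell (harness21).  Prover seat hodgecm-mathlib-F0P2-p11 (g0) (L1 re-deal s1969∕s1970, LEAD F0P6-plan (g14)
EMIT #1 «p22» (R1-α)), Track B «K2-LIT» ∕ hLiu418 #184♮, ROAD Φ, G5-b = Φ7-3, organ (R1-α), device (b3-ii)(A) «which middle orbit carries the corner of a rank-one
index» (sequel of ★ p861243 `K2LiuRankOneMiddleOrbitSum`).  THEOREMS ONLY.
-/
import Summits.HodgeConjecture.HodgeConjecture.Theorems.K2LiuRankOneMiddleOrbitSum              -- ★ p861243 (b3-i) (+ ★ α2c, ★ α2d-1∕2, ★ Φ2 file 6)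
import Summits.HodgeConjecture.HodgeConjecture.Theorems.K2LiuSiegelEisensteinCoeffRankOneCorner  -- ★ Φ7-1 (i): `mulVec_eq_smul_of_skew` (rank-one skew algebra)
import HarnessLib

/-!
# Crux `HLiu418`, ROAD Φ, organ Φ7-3 (R1-α), device (b3-ii)(A): WHICH MIDDLE ORBIT CARRIES THE CORNER OF A RANK-ONE INDEX —
# for `S = u ⊗ w` `T_L`-skew and `g ∈ GL₂(L)`: `S^{Λĝ}_𝔸` is supported on the corner `(1,1)` iff `[w] = [g₁]` in `ℙ¹(L)`

Cell `hodgecm-mathlib`, crux item hLiu418 = `stmt-HodgeConjecture-24832` (helper lane, count-neutral); squad K2 ∕ K2Liu, LEAD F0P6-plan (g14), desk (R1-α)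
K2E5-p17 (g8); prover F0P2-p11 (g0).  THEOREMS ONLY (no `def`, no `instance`, no notation, no named-fact hypothesis, no `sorry`).

WHY.  ★ p861243 `hasSum_middle_cell_twisted` writes the middle term of the `S`-th coefficient as `Σ_{p ∈ ℙ¹(L)} V_S(p)`, the `p`-th term being the twisted inner integral of
the orbit `O(w₀ Λ(γ p)^)`.  By the sharp criterion ★ `forall_stabilizer_unipDeltaChar_eq_one_iff_corner` ∕ ★ `tsum_middle_orbit_eq_zero_of_ne_corner` the orbit of `[w₀ p']`
survives only if the conjugated index `S^{p'}_𝔸 = frame₂₂(p') · S_𝔸 · (deltaBlock p')⁻¹` is supported on the corner of the pattern `χ = ![0, 1]` of `w₀`.  This file decides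
that condition for the Levi representatives `p' = Λĝ` and a RANK-ONE `T_L`-skew index `S = u ⊗ w` (`S_{ij} = u_i w_j`, `u, w ≠ 0`): over `L`, `S^{Λĝ} = D₀ S g⁻¹ =
(D₀ u) ⊗ (w g⁻¹)` with `D₀ = T⁻¹ (g⁻¹)^* T` (★ α2c `deltaBlock_levi_apply`, ★ Φ2 file 6 `exists_rat_levi_blocks`), skewness aligns `T u` with `conj ∘ w`
(★ Φ7-1 (i) `mulVec_eq_smul_of_skew`), and the corner condition becomes `(w g⁻¹)₀ = 0`, i.e. `w ∈ L · g₁` (row `1` of `g`).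
* §1 (a field `K`, `σ : K →+* K`): `vecMulVec_corner_iff` — `diag χ (a ⊗ b) diag χ = a ⊗ b ⟺ b₀ = 0` when `a ≠ 0` and `b₀ = 0 → a₀ = 0`; `apply_zero_iff_of_skew_link` — the
  skew link `T a = λ · σ ∘ b`, `λ ≠ 0`; `vecMul_inv_apply_zero_eq_zero_iff` — `(w g⁻¹)₀ = 0 ⟺ ∃ c : Kˣ, c • g₁ = w`.
* §2 (the datum of #41, `n = 2`): **`corner_levi_iff_mk_eq`** — for `S ∈ skewMatrices c T_L` with `S = u ⊗ w`, `u ≠ 0`, `w ≠ 0`, and `g ∈ GL₂(L)`: the corner identity of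
  ★ `exists_corner_supported_levi` ∕ ★ p861210 `conj_unipDeltaChar_conj_invariant` for `p' = Λĝ` at the pattern `![0, 1]` holds iff
  `Projectivization.mk L w _ = Projectivization.mk L (g 1) _` — the survivor of ★ p861243's `ℙ¹(L)`-sum is the point `[w]`.
References: [KudlaRallis1994] §2; [Shimura1997] §18.3 (singular Fourier coefficients, rank-`r` indices); [MoeglinWaldspurger1995] II.1.7; [GelbartPiatetskishapiroRallis1987]
Part A §§1–2.
HONEST LABEL.  Count-neutral helper: `HC_CM` is proved only modulo the 7 printed citations (2 remaining named inputs: hLiu418 = `stmt-HodgeConjecture-24832`,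
h413 = `stmt-HodgeConjecture-24833`) until rung 0 closes.
-/

set_option autoImplicit false
set_option linter.dupNamespace false -- the mandated namespace repeats `HodgeConjecture.HodgeConjecture`

noncomputable section

open scoped Matrix
open NumberField IsDedekindDomain
open Literature.NumberTheory.Automorphic Literature.NumberTheory.Automorphic.UnitaryGroup Literature.NumberTheory.GaloisRepresentations
open Literature.NumberTheory.GelbartRogawski1991 Literature.NumberTheory.GelbartRogawski1991.GRConstruction
open Literature.NumberTheory.GelbartRogawski1991.AdaptedBlocks
open Literature.NumberTheory.K2Lit.SiegelDoubled
open UnitaryDualPair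

namespace Summit.HodgeConjecture.HodgeConjecture.Cruxes.HLiu418.K2LiuRankOneCornerOrbit

open K2LiuSiegelUnipotentFourierDefs K2LiuSiegelDoubledRationalPoints K2LiuSiegelLeviConjUnipDeltaChar K2LiuSiegelRationalLeviDecomposition
  K2LiuSiegelMiddleCellLeviCriterion K2LiuSiegelEisensteinCoeffRankOneCorner

/-! ## §1 Field algebra: the corner of a rank-one matrix, the skew link, and rows up to scalars -/

section Algebra

variable {K : Type*} [Field K]

/-- **the corner condition for a rank-one matrix**: for `a ≠ 0` and `b` with `b₀ = 0 → a₀ = 0`, `a ⊗ b = diag(0,1) · (a ⊗ b) · diag(0,1) ⟺ b₀ = 0`. [folklore] -/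
theorem vecMulVec_corner_iff {a b : Fin 2 → K} (ha : a ≠ 0) (hab : b 0 = 0 → a 0 = 0) :
    Matrix.vecMulVec a b = Matrix.diagonal (![0, 1] : Fin 2 → K) * Matrix.vecMulVec a b * Matrix.diagonal (![0, 1] : Fin 2 → K) ↔ b 0 = 0 := by
  constructor
  · intro h
    by_contra hb
    apply ha
    funext i
    have hi := congrFun (congrFun h.symm i) 0
    simp only [Matrix.mul_apply, Matrix.diagonal_apply, Matrix.vecMulVec_apply, Fin.sum_univ_two, Matrix.cons_val_zero, Matrix.cons_val_one,
      Fin.isValue] at hi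
    -- `hi : (corner entry (i,0) of the sandwiched matrix) = a i * b 0`; the left side vanishes as `χ 0 = 0`
    have h0 : a i * b 0 = 0 := by
      rw [← hi]
      fin_cases i <;> simp
    exact (mul_eq_zero.1 h0).resolve_right hb
  · intro hb
    have ha0 := hab hb
    refine Matrix.ext fun i j => ?_
    simp only [Matrix.mul_apply, Matrix.diagonal_apply, Matrix.vecMulVec_apply, Fin.sum_univ_two, Matrix.cons_val_zero, Matrix.cons_val_one, Fin.isValue]
    fin_cases i <;> fin_cases j <;> simp [ha0, hb]

/-- **the skew link**: if `T a = λ • (σ ∘ b)` with `T = diag t`, `t₀ ≠ 0`, `λ ≠ 0` and `σ` injective, then `a₀ = 0 ⟺ b₀ = 0`. [folklore] -/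
theorem apply_zero_iff_of_skew_link (σ : K →+* K) {t : Fin 2 → K} (ht : t 0 ≠ 0) {a b : Fin 2 → K} {lam : K} (hlam : lam ≠ 0)
    (h : Matrix.diagonal t *ᵥ a = lam • fun i => σ (b i)) : a 0 = 0 ↔ b 0 = 0 := by
  have h0 := congrFun h 0
  simp only [Matrix.mulVec_diagonal, Pi.smul_apply, smul_eq_mul] at h0
  constructor
  · intro ha
    rw [ha, mul_zero] at h0
    have : σ (b 0) = 0 := by
      rcases mul_eq_zero.1 h0.symm with h1 | h1
      · exact absurd h1 hlam
      · exact h1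
    exact (map_eq_zero_iff σ σ.injective).1 this
  · intro hb
    rw [hb, map_zero, mul_zero] at h0
    exact (mul_eq_zero.1 h0).resolve_left ht

/-- **rows up to scalars**: `(w ᵥ* g⁻¹)₀ = 0 ⟺ ∃ c : Kˣ, c • g₁ = w` (`w = (w g⁻¹) g = (w g⁻¹)₀ g₀ + (w g⁻¹)₁ g₁`; `g₁ g⁻¹ = e₁`). [folklore] -/
theorem vecMul_inv_apply_zero_eq_zero_iff (g : GL (Fin 2) K) {w : Fin 2 → K} (hw : w ≠ 0) :
    (w ᵥ* ((g⁻¹ : GL (Fin 2) K) : Matrix (Fin 2) (Fin 2) K)) 0 = 0 ↔ ∃ c : Kˣ, c • (g : Matrix (Fin 2) (Fin 2) K) 1 = w := by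
  obtain ⟨g', hg'⟩ := exists_gl_row_eq hw
  have hrow : ((g' * g⁻¹ : GL (Fin 2) K) : Matrix (Fin 2) (Fin 2) K) 1 = w ᵥ* ((g⁻¹ : GL (Fin 2) K) : Matrix (Fin 2) (Fin 2) K) := by
    rw [Units.val_mul, ← hg']
    funext j
    rw [Matrix.mul_apply, Matrix.vecMul, dotProduct]
  rw [← hg', ← mul_inv_apply_one_zero_eq_zero_iff g g', hrow, hg']

end Algebra

/-! ## §2 The datum of #41 (`n = 2`): the corner identity for `p' = Λĝ` and a rank-one `T_L`-skew index -/

section Doubled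

variable (L : Type) [Field L] [NumberField L] [IsCMField L]
variable {N M : ℕ} (e : Fin N × Fin M ≃ Fin 2)
  (dV : Fin N → L) (hdV : ∀ i, IsCMField.complexConj L (dV i) = dV i)
  (dW : Fin M → L) (hdW : ∀ i, IsCMField.complexConj L (dW i) = dW i)
  (Λ : GL (Fin 2) (AdeleRing (𝓞 L) L) →* HA L e dV hdV dW hdW)
  (hΛ : ∀ g : GL (Fin 2) (AdeleRing (𝓞 L) L), blk L e dV hdV dW hdW (Λ g) =
    cayR (AdeleRing (𝓞 L) L) (Fin 2) * Matrix.fromBlocks (g : Matrix (Fin 2) (Fin 2) (AdeleRing (𝓞 L) L)) 0 0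
      (((gramR L e dV hdV dW hdW).map ((algebraMap L (AdeleRing (𝓞 L) L)).comp (algebraMap (Fp L) L)))⁻¹ *
        (((g⁻¹ : GL (Fin 2) (AdeleRing (𝓞 L) L)) : Matrix (Fin 2) (Fin 2) (AdeleRing (𝓞 L) L)).map
          (conjAdele (Fp L) L (IsCMField.complexConj L)))ᵀ *
        (gramR L e dV hdV dW hdW).map ((algebraMap L (AdeleRing (𝓞 L) L)).comp (algebraMap (Fp L) L))) *
      cayRinv (AdeleRing (𝓞 L) L) (Fin 2))

include hΛ in
/-- **WHICH LEVI ORBIT CARRIES THE CORNER OF A RANK-ONE INDEX.**  For `S ∈ skewMatrices c T_L` of rank one, `S = u ⊗ w` with `u ≠ 0`, `w ≠ 0`, and `g ∈ GL₂(L)`: the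
conjugated index `S^{Λĝ}_𝔸 = frame₂₂(Λĝ) · S_𝔸 · (deltaBlock Λĝ)⁻¹` is supported on the corner of the pattern `![0, 1]` (the hypothesis `hcorner` of ★ p861210
`conj_unipDeltaChar_conj_invariant`, i.e. the right-hand side of ★ `forall_stabilizer_unipDeltaChar_eq_one_iff_corner` at `χ = ![0, 1]`, `p' = Λĝ`) IF AND ONLY IF
`[w] = [g₁]` in `ℙ¹(L)` — so in ★ p861243 `hasSum_middle_cell_twisted` exactly the term `p = [w]` can survive. [cite: KudlaRallis1994, §2] [cite: Shimura1997, §18.3]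
[cite: MoeglinWaldspurger1995, II.1.7] -/
theorem corner_levi_iff_mk_eq (hdV0 : ∀ i, dV i ≠ 0) (hdW0 : ∀ i, dW i ≠ 0) {S : Matrix (Fin 2) (Fin 2) L}
    (hS : S ∈ skewMatrices ((IsCMField.complexConj L : L ≃ₐ[Fp L] L) : L →+* L) ((gramR L e dV hdV dW hdW).map (algebraMap (Fp L) L)))
    {u w : Fin 2 → L} (hS1 : S = Matrix.vecMulVec u w) (hu : u ≠ 0) (hw : w ≠ 0) (g : GL (Fin 2) L) :
    (Matrix.fromBlocks (1 : Matrix (Fin 2) (Fin 2) (AdeleRing (𝓞 L) L)) 0 (-1) 1 *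
            blk L e dV hdV dW hdW (Λ (Matrix.GeneralLinearGroup.map (algebraMap L (AdeleRing (𝓞 L) L)) g)) * Matrix.fromBlocks 1 0 1 1).toBlocks₂₂ *
          S.map (algebraMap L (AdeleRing (𝓞 L) L)) * (deltaBlock L e dV hdV dW hdW (Λ (Matrix.GeneralLinearGroup.map (algebraMap L (AdeleRing (𝓞 L) L)) g)))⁻¹ =
        Matrix.diagonal (fun i => algebraMap L (AdeleRing (𝓞 L) L) ((![0, 1] : Fin 2 → L) i)) *
          ((Matrix.fromBlocks (1 : Matrix (Fin 2) (Fin 2) (AdeleRing (𝓞 L) L)) 0 (-1) 1 *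
              blk L e dV hdV dW hdW (Λ (Matrix.GeneralLinearGroup.map (algebraMap L (AdeleRing (𝓞 L) L)) g)) * Matrix.fromBlocks 1 0 1 1).toBlocks₂₂ *
            S.map (algebraMap L (AdeleRing (𝓞 L) L)) * (deltaBlock L e dV hdV dW hdW (Λ (Matrix.GeneralLinearGroup.map (algebraMap L (AdeleRing (𝓞 L) L)) g)))⁻¹) *
          Matrix.diagonal (fun i => algebraMap L (AdeleRing (𝓞 L) L) ((![0, 1] : Fin 2 → L) i)) ↔
      Projectivization.mk L w hw = Projectivization.mk L ((g : Matrix (Fin 2) (Fin 2) L) 1) (row_ne_zero g 1) := by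
  obtain ⟨hT, -, -, -⟩ := gramRL_facts L e dV hdV dW hdW hdV0 hdW0
  -- the rational blocks of `Λĝ`: `A₀ = g`, `D₀ = T⁻¹ (g⁻¹)^* T`
  have hp'P := isSiegelDelta_levi_apply L e dV hdV dW hdW Λ hΛ (Matrix.GeneralLinearGroup.map (algebraMap L (AdeleRing (𝓞 L) L)) g)
  have hp'r := levi_map_mem_ratH L e dV hdV dW hdW Λ hΛ hdV0 hdW0 g
  obtain ⟨A₀, D₀, hA₀, ha, hd, hrel⟩ := exists_rat_levi_blocks L e dV hdV dW hdW hdV0 hdW0 hp'P hp'r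
  set f := algebraMap L (AdeleRing (𝓞 L) L) with hf
  set c : L →+* L := ((IsCMField.complexConj L : L ≃ₐ[Fp L] L) : L →+* L) with hc
  set T : Matrix (Fin 2) (Fin 2) L := (gramR L e dV hdV dW hdW).map (algebraMap (Fp L) L) with hTdef
  have hinj : Function.Injective (fun A : Matrix (Fin 2) (Fin 2) L => A.map f) :=
    fun A B h => Matrix.ext fun i j => AdeleRing.algebraMap_injective (𝓞 L) L (congrFun (congrFun h i) j)
  have hAg : A₀ = (g : Matrix (Fin 2) (Fin 2) L) := by
    apply hinj
    show A₀.map f = (g : Matrix (Fin 2) (Fin 2) L).map f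
    rw [← ha, deltaBlock_levi_apply L e dV hdV dW hdW Λ hΛ]
    rfl
  subst hAg
  -- `S^{Λĝ}_𝔸 = (D₀ S g⁻¹) ⊗ 1`
  have hgdet : IsUnit (g : Matrix (Fin 2) (Fin 2) L).det := Matrix.isUnits_det_units g
  have hmap : (Matrix.fromBlocks (1 : Matrix (Fin 2) (Fin 2) (AdeleRing (𝓞 L) L)) 0 (-1) 1 *
          blk L e dV hdV dW hdW (Λ (Matrix.GeneralLinearGroup.map (algebraMap L (AdeleRing (𝓞 L) L)) g)) * Matrix.fromBlocks 1 0 1 1).toBlocks₂₂ *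
        S.map f * (deltaBlock L e dV hdV dW hdW (Λ (Matrix.GeneralLinearGroup.map (algebraMap L (AdeleRing (𝓞 L) L)) g)))⁻¹ =
      (D₀ * S * (g : Matrix (Fin 2) (Fin 2) L)⁻¹).map f := by
    rw [Matrix.map_mul, Matrix.map_mul, map_nonsing_inv_of_isUnit f hgdet, ← ha, ← hd]
  have hdiag : Matrix.diagonal (fun i => f ((![0, 1] : Fin 2 → L) i)) = (Matrix.diagonal (![0, 1] : Fin 2 → L)).map f := by
    rw [Matrix.diagonal_map (map_zero f)]
  rw [hmap, hdiag, ← Matrix.map_mul, ← Matrix.map_mul, hinj.eq_iff]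
  -- over `L`: `D₀ S g⁻¹ = (D₀ u) ⊗ (w g⁻¹)`
  have hshape : D₀ * S * (g : Matrix (Fin 2) (Fin 2) L)⁻¹ = Matrix.vecMulVec (D₀ *ᵥ u) (w ᵥ* (g : Matrix (Fin 2) (Fin 2) L)⁻¹) := by
    rw [hS1, Matrix.mul_vecMulVec, Matrix.vecMulVec_mul]
  rw [hshape]
  -- `D₀` is invertible (`g^* T D₀ = T`), so `D₀ u ≠ 0`
  have hD₀det : IsUnit D₀.det := by
    have h1 := congrArg Matrix.det hrel
    rw [Matrix.det_mul, Matrix.det_mul] at h1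
    exact isUnit_of_mul_isUnit_right (h1 ▸ hT)
  have ha0 : D₀ *ᵥ u ≠ 0 := fun h0 => hu (by
    have := congrArg (fun v => D₀⁻¹ *ᵥ v) h0
    simpa only [Matrix.mulVec_mulVec, Matrix.nonsing_inv_mul _ hD₀det, Matrix.one_mulVec, Matrix.mulVec_zero] using this)
  -- the skew link: `T (D₀ u) = (g^*)⁻¹ (T u) = λ • c ∘ (w g⁻¹)`
  obtain ⟨t₀, ht₀⟩ : ∃ t : Fin 2 → L, T = Matrix.diagonal t := by
    have hex : ∃ t : Fin 2 → Fp L, gramR L e dV hdV dW hdW = Matrix.diagonal t := by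
      refine ⟨(fun mn : Fin N × Fin M => (⟨dV mn.1, (IsCMField.complexConj_eq_self_iff (K := L) (dV mn.1)).1 (hdV mn.1)⟩ : Fp L) *
        (⟨dW mn.2, (IsCMField.complexConj_eq_self_iff (K := L) (dW mn.2)).1 (hdW mn.2)⟩ : Fp L)) ∘ e.symm, ?_⟩
      unfold gramR gram realDiagonal
      rw [Matrix.diagonal_kronecker_diagonal, Matrix.reindex_apply, Matrix.submatrix_diagonal_equiv]
    obtain ⟨t, ht⟩ := hex
    exact ⟨fun i => algebraMap (Fp L) L (t i), by rw [hTdef, ht, Matrix.diagonal_map (map_zero _)]⟩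
  have hTdet' : IsUnit (Matrix.diagonal t₀).det := by rw [← ht₀]; exact hT
  have ht0 : ∀ i, t₀ i ≠ 0 := by
    intro i hi
    have hdet := hTdet'
    rw [Matrix.det_diagonal] at hdet
    exact (Finset.prod_ne_zero_iff.1 hdet.ne_zero) i (Finset.mem_univ i) hi
  obtain ⟨k, hk⟩ : ∃ k, w k ≠ 0 := Function.ne_iff.1 hw
  have hskew : Matrix.diagonal t₀ * S + (S.map c)ᵀ * Matrix.diagonal t₀ = 0 := by
    rw [← ht₀]; exact hS
  have hTu := mulVec_eq_smul_of_skew c hS1 hskew hk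
  set lam : L := -(((fun i => c (u i)) ᵥ* Matrix.diagonal t₀) k / w k) with hlam
  have hlam0 : lam ≠ 0 := by
    intro h0
    rw [h0, zero_smul] at hTu
    apply hu
    have := congrArg (fun v => (Matrix.diagonal t₀)⁻¹ *ᵥ v) hTu
    simpa only [Matrix.mulVec_mulVec, Matrix.nonsing_inv_mul _ hTdet', Matrix.one_mulVec, Matrix.mulVec_zero] using this
  -- `T (D₀ u) = ((g^*)⁻¹) (T u)` from `g^* T D₀ = T`
  have hlink : Matrix.diagonal t₀ *ᵥ (D₀ *ᵥ u) = lam • fun i => c ((w ᵥ* (g : Matrix (Fin 2) (Fin 2) L)⁻¹) i) := by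
    have hgc : IsUnit (((g : Matrix (Fin 2) (Fin 2) L).map c)ᵀ).det := by
      rw [Matrix.det_transpose, ← RingHom.mapMatrix_apply, ← RingHom.map_det]; exact hgdet.map _
    have hTD : Matrix.diagonal t₀ * D₀ = (((g : Matrix (Fin 2) (Fin 2) L).map c)ᵀ)⁻¹ * Matrix.diagonal t₀ := by
      have h1 : ((g : Matrix (Fin 2) (Fin 2) L).map c)ᵀ * (T * D₀) = T := by rw [← Matrix.mul_assoc]; exact hrel
      rw [← ht₀, ← Matrix.nonsing_inv_mul_cancel_left _ (T * D₀) hgc, h1]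
    have hinvT : (((g : Matrix (Fin 2) (Fin 2) L).map c)ᵀ)⁻¹ = (((g : Matrix (Fin 2) (Fin 2) L)⁻¹).map c)ᵀ := by
      rw [map_nonsing_inv_of_isUnit c hgdet, Matrix.transpose_nonsing_inv]
    rw [Matrix.mulVec_mulVec, hTD, hinvT, ← Matrix.mulVec_mulVec, hTu, Matrix.mulVec_smul, Matrix.mulVec_transpose]
    congr 1
    funext i
    rw [RingHom.map_vecMul]
    rfl
  have hiff := apply_zero_iff_of_skew_link c (ht0 0) hlam0 hlink
  rw [vecMulVec_corner_iff ha0 hiff.2, ← Matrix.coe_units_inv, vecMul_inv_apply_zero_eq_zero_iff g hw, Projectivization.mk_eq_mk_iff]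

end Doubled

end Summit.HodgeConjecture.HodgeConjecture.Cruxes.HLiu418.K2LiuRankOneCornerOrbit

end
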